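import Summits.Ventures.QEC.CircuitDistance.PortZSector
import Summits.Ventures.QEC.CircuitDistance.SchedXSector
import HarnessLib

/-!
# Q4 lane, ₛ-spine (9Z): the `Z`-SECTOR THEOREM for any CNOT order — mirror of `SchedXSector.lean` (`PortZSector.lean` re-pointed to
# `zDEMₛ σ`/`Gen.*` under `hσ : σ.CycleFacts S`; venture QEC, experiment cell CDX, seat qec-cdx-type-2; proofs verbatim; nothing here
# asserts a value of `d_circ`)

Reused unchanged (order-free): `ZTable.covers`, `zNontrivial_add_stab`, the translation equivalences, the `Fibre.*` layer. Re-pointed: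
`zDetₛ_translate`, `zSymmₛ`, `zDetₛ_eq_of_zKind`/`_eq_empty_of_zKind`, **`zcovers_soundₛ`**, `silent_zDEMₛ`, **`no_zLogical_of_leavesₛ (hσ)`**.
-/

namespace Summit.Ventures.QEC.CircuitDistance

open Literature.InformationTheory.QuantumCodes

variable {ℓ m : ℕ} [NeZero ℓ] [NeZero m]

/-! ## Translations as symmetries of the `Z`-sector DEM of a scheduled circuit -/

/-- Translated `Z`-sector columns, any order (cf. `zDet_translate`). -/
theorem zDetₛ_translate (σ : SMSchedule) (S : SMCode ℓ m) (Nc : ℕ) (f : Fault ℓ m) (t : BB.Mono ℓ m) :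
    zDetₛ σ S Nc (f.translate t) = (zDetₛ σ S Nc f).map (detTranslateEquiv t).toEmbedding := by
  ext ⟨s, j⟩
  rw [Finset.mem_map_equiv]
  have hsymm : (detTranslateEquiv t).symm (s, j) = (s, j + -t) := rfl
  rw [hsymm]
  simp only [zDetₛ, Finset.mem_filter, Finset.mem_product, Finset.mem_range, Finset.mem_univ, and_true,
    Gen.detX_translate_singleton, sub_eq_add_neg]

/-- **Translations are symmetries of the `Z`-sector DEM** of any order (cf. `zSymm`). -/
def zSymmₛ (σ : SMSchedule) (S : SMCode ℓ m) (T : ZTable ℓ m) (Nc : ℕ) (t : BB.Mono ℓ m) :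
    Fibre.Symmetry (zDEMₛ σ S T Nc) (scope Nc) where
  onCol := faultTranslateEquiv t
  onDet := detTranslateEquiv t
  onGen := genTranslateEquiv t
  det_map f := zDetₛ_translate σ S Nc f t
  cls_map f := by
    show ((f.translate t).zKind.bind fun ki => (T.cls ki.1).map (trQ ki.2)) =
      (f.zKind.bind fun ki => (T.cls ki.1).map (trQ ki.2)).map (genTranslateEquiv t)
    rw [Fault.zKind_translate]
    rcases f.zKind with _ | ⟨k, i⟩
    · rfl
    · simp only [Option.map_some, Option.bind_some, Option.map_map]
      cases T.cls k with
      | none => rfl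
      | some g => simp only [Option.map_some, Function.comp, genTranslateEquiv_apply, trQ_add]
  scope_map f := by
    show (1 ≤ (f.translate t).cyc ∧ (f.translate t).cyc ≤ Nc) ↔ (1 ≤ f.cyc ∧ f.cyc ≤ Nc)
    rw [Fault.cyc_translate]

/-! ## Coverage (the checker `ZTable.covers` of the tree is order-free and reused) -/

/-- The `Z`-sector column of a fault equals that of its representative (cf. `zDet_eq_of_zKind`). -/
theorem zDetₛ_eq_of_zKind (σ : SMSchedule) (S : SMCode ℓ m) (Nc : ℕ) (f : Fault ℓ m) {k : ZKind} {i : BB.Mono ℓ m}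
    (h : f.zKind = some (k, i)) : zDetₛ σ S Nc f = zDetₛ σ S Nc (k.fault f.cyc i) := by
  unfold zDetₛ; congr 1; funext p; rw [(Gen.zColumn_eq_of_zKind S Nc (allEventsₛ σ Nc) f h).1]

/-- A fault without `Z`-part has an empty `Z`-sector column. -/
theorem zDetₛ_eq_empty_of_zKind (σ : SMSchedule) (S : SMCode ℓ m) (Nc : ℕ) (f : Fault ℓ m) (h : f.zKind = none) : zDetₛ σ S Nc f = ∅ := by
  unfold zDetₛ
  rw [Finset.filter_eq_empty_iff]
  intro p _
  rw [(Gen.zColumn_zero_of_zKind S Nc (allEventsₛ σ Nc) f h).1]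
  exact Bool.false_ne_true

/-- **Coverage soundness** for the `Z`-sector DEM. -/
theorem zcovers_soundₛ {σ : SMSchedule} {S : SMCode ℓ m} (hσ : σ.CycleFacts S) (T : ZTable ℓ m) (hS : T.ShapeCorrectₛ σ S) (Nc : ℕ) (e : LeafEntry ℓ m)
    (h : T.covers S Nc e = true) : Fibre.Covers (zDEMₛ σ S T Nc) (scope Nc) encDet e.word e.leaf := by
  unfold ZTable.covers at h
  simp only [Bool.and_eq_true, decide_eq_true_eq, List.all_eq_true] at h
  obtain ⟨hlen, hall⟩ := h
  refine ⟨encDet_injective, hlen, fun f hf j hcls => ?_, fun f hf hcls => ?_⟩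
  · obtain ⟨h₁, h₂⟩ := hf
    change (f.zKind.bind fun ki => (T.cls ki.1).map (trQ ki.2)) = some e.word[j] at hcls
    rcases hk : f.zKind with _ | ⟨k, i⟩
    · rw [hk] at hcls; simp at hcls
    · rw [hk, Option.bind_some] at hcls
      have hmem : (k, i) ∈ ZKind.all.product (monoList ℓ m) :=
        List.pair_mem_product.2 ⟨ZKind.mem_all k (fun lay => Fault.zKind_ne_zero hk lay), mem_monoList i⟩
      have hki := hall (k, i) hmem
      simp only [hcls] at hki
      rw [List.all_eq_true] at hki
      have hj := hki j (List.mem_range.2 j.2)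
      simp only [Bool.or_eq_true, Bool.not_eq_true', decide_eq_false_iff_not, List.all_eq_true, List.any_eq_true,
        decide_eq_true_eq] at hj
      rcases hj with hj | hj
      · exact absurd (List.getElem?_eq_getElem j.2) hj
      · obtain ⟨c, hc, hcc⟩ := hj (f.cyc - 1) (List.mem_range.2 (by omega))
        refine ⟨c, hc, ?_⟩
        rw [hcc, Nat.sub_add_cancel h₁, ZTable.detFast_eq_zDetₛ hσ (hS k (ZKind.mem_all k (fun lay => Fault.zKind_ne_zero hk lay)))
          Nc i f.cyc h₁ h₂, ← zDetₛ_eq_of_zKind σ S Nc f hk]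
        rfl
  · obtain ⟨h₁, h₂⟩ := hf
    change (f.zKind.bind fun ki => (T.cls ki.1).map (trQ ki.2)) = none at hcls
    rcases hk : f.zKind with _ | ⟨k, i⟩
    · exact Or.inl (zDetₛ_eq_empty_of_zKind σ S Nc f hk)
    · rw [hk, Option.bind_some] at hcls
      have hkall : k ∈ ZKind.all := ZKind.mem_all k (fun lay => Fault.zKind_ne_zero hk lay)
      have hmem : (k, i) ∈ ZKind.all.product (monoList ℓ m) := List.pair_mem_product.2 ⟨hkall, mem_monoList i⟩
      have hki := hall (k, i) hmem
      simp only [hcls] at hki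
      rw [List.all_eq_true] at hki
      have hc := hki (f.cyc - 1) (List.mem_range.2 (by omega))
      simp only [Bool.or_eq_true, decide_eq_true_eq, List.any_eq_true] at hc
      have hcol : (T.detFast S k i (f.cyc - 1 + 1)).image encDet = (zDetₛ σ S Nc f).image encDet := by
        rw [Nat.sub_add_cancel h₁, ZTable.detFast_eq_zDetₛ hσ (hS k hkall) Nc i f.cyc h₁ h₂, ← zDetₛ_eq_of_zKind σ S Nc f hk]
      rcases hc with hc | ⟨c, hcn, hcc⟩
      · left
        rw [hcol, Finset.image_eq_empty] at hc
        exact hc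
      · right
        exact ⟨c, hcn, by rw [hcc, hcol]; rfl⟩

/-! ## Silence -/

/-- An undetectable fault set is silent in the `Z`-sector DEM. -/
theorem silent_zDEMₛ (σ : SMSchedule) (S : SMCode ℓ m) (T : ZTable ℓ m) (Nc : ℕ) (F : Finset (Fault ℓ m)) (hU : Gen.Undetectable S Nc (allEventsₛ σ Nc) F) :
    Fibre.Silent (zDEMₛ σ S T Nc) F := by
  intro d
  obtain ⟨s, i⟩ := d
  show Even ((F.filter fun f => (s, i) ∈ zDetₛ σ S Nc f).card)
  have hdet := (hU.2 (s + 1) i).1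
  rw [Gen.detX_eq_bsum] at hdet
  unfold bsum at hdet
  have hfilt : (F.filter fun f => (s, i) ∈ zDetₛ σ S Nc f) = F.filter fun f => s < Nc + 2 ∧ Gen.detX S Nc (allEventsₛ σ Nc) {f} (s + 1) i = true := by
    apply Finset.filter_congr
    intro f _
    simp [zDetₛ]
  rw [hfilt]
  by_cases hs : s < Nc + 2
  · simp only [hs, true_and]
    rw [Nat.even_iff]
    rcases Nat.mod_two_eq_zero_or_one (F.filter fun f => Gen.detX S Nc (allEventsₛ σ Nc) {f} (s + 1) i = true).card with h0 | h1
    · exact h0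
    · rw [h1] at hdet; simp at hdet
  · have : (F.filter fun f => s < Nc + 2 ∧ Gen.detX S Nc (allEventsₛ σ Nc) {f} (s + 1) i = true) = ∅ :=
      Finset.filter_eq_empty_iff.2 (fun f _ h => hs h.1)
    rw [this, Finset.card_empty]
    exact ⟨0, rfl⟩

/-! ## The sector theorem -/

/-- **`Z`-SECTOR THEOREM.** Tables correct; every listed leaf well-formed, covered and UNSAT with weight `w` and budget
`≤ 1`; the list COMPLETE up to translation for `Z`-nontrivial words of weight `≤ w` ⇒ no undetectable fault set of `≤ w`
operations of the `N₀`-cycle circuit has a `Z`-nontrivial residual. -/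
theorem no_zLogical_of_leavesₛ {σ : SMSchedule} {S : SMCode ℓ m} (hσ : σ.CycleFacts S) (T : ZTable ℓ m)
    (hS : T.ShapeCorrectₛ σ S) (hC : T.ClassCorrect S)
    (N₀ w : ℕ) (leaves : List (LeafEntry ℓ m))
    (hwf : ∀ e ∈ leaves, e.leaf.wf = true ∧ T.covers S N₀ e = true ∧ e.word.Nodup ∧
      e.leaf.w = w ∧ e.leaf.budget ≤ 1 ∧
      (Census.CNFEncode.cnfEncodeAny e.leaf.n e.leaf.rows e.leaf.us e.leaf.w).Unsat)
    (hcomplete : ∀ x : Finset (Finset (BB.Mono ℓ m ⊕ BB.Mono ℓ m)), ZNontrivial S (∑ g ∈ x, indic g) → x.card ≤ w →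
      ∃ e ∈ leaves, ∃ t : BB.Mono ℓ m, x = (e.word.map (trQ t)).toFinset) :
    ¬ ∃ F : Finset (Fault ℓ m), Gen.Undetectable S N₀ (allEventsₛ σ N₀) F ∧ Gen.dataZ S (allEventsₛ σ N₀) F ∉ rowSpace S.toCode.HZ ∧ faultCount F ≤ w := by
  classical
  rintro ⟨F, hU, hL, hw⟩
  obtain ⟨F₁, hR, hcard, himg, hX, hZ, hdX, hdZ⟩ := Gen.exists_reduced S N₀ (allEventsₛ σ N₀) F
  have hU₁ : Gen.Undetectable S N₀ (allEventsₛ σ N₀) F₁ := by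
    refine ⟨fun f' hf' => ?_, fun t i => ⟨?_, ?_⟩⟩
    · have : f'.loc ∈ F.image Fault.loc := himg (Finset.mem_image_of_mem _ hf')
      obtain ⟨f, hf, hfl⟩ := Finset.mem_image.1 this
      rw [← Fault.ev_eq_of_loc_eq hfl]; exact hU.1 f hf
    · rw [hX]; exact (hU.2 t i).1
    · rw [hZ]; exact (hU.2 t i).2
  have hNT : ZNontrivial S (Gen.dataZ S (allEventsₛ σ N₀) F₁) := by
    refine ⟨(residual_syndrome_zeroₛ hσ N₀ F₁ hU₁).2, ?_⟩
    rw [hdZ]; exact hL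
  have hscope : ∀ f ∈ F₁, f ∈ scope (ℓ := ℓ) (m := m) N₀ := by
    intro f hf
    have := hU₁.1 f hf
    rw [hσ.mem_allEventsₛ_iff, Fault.ev_cyc] at this
    exact this
  have key := Fibre.no_silent_nontrivial (zDEMₛ σ S T N₀) (scope N₀) (classHyp_zDEMₛ hσ T hS hC N₀) (ZNontrivial S)
    (fun v s hs => zNontrivial_add_stab S v s hs) w ?_ F₁ hscope (hcard.trans hw) (silent_zDEMₛ σ S T N₀ F₁ hU₁)
  · apply key
    show ZNontrivial S (∑ f ∈ F₁, Gen.dataZ S (allEventsₛ σ N₀) {f})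
    rw [← Gen.dataZ_eq_sum]; exact hNT
  intro x hx hxw
  obtain ⟨e, he, t, rfl⟩ := hcomplete x hx hxw
  obtain ⟨hwfe, hcov, hnd, hwe, hb, hunsat⟩ := hwf e he
  have hcovers := zcovers_soundₛ hσ T hS N₀ e hcov
  have hlen : e.word.length = e.leaf.k := hcovers.2.1
  have hmap : (e.word.map (trQ t)).toFinset = e.word.toFinset.map (zSymmₛ σ S T N₀ t).onGen.toEmbedding := by
    ext g
    simp only [List.mem_toFinset, List.mem_map, Finset.mem_map_equiv]
    show (∃ a, a ∈ e.word ∧ trQ t a = g) ↔ (genTranslateEquiv t).symm g ∈ e.word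
    constructor
    · rintro ⟨a, ha, rfl⟩
      have : (genTranslateEquiv t).symm (genTranslateEquiv t a) = a := Equiv.symm_apply_apply _ _
      rw [genTranslateEquiv_apply] at this; rw [this]; exact ha
    · intro hg
      refine ⟨(genTranslateEquiv t).symm g, hg, ?_⟩
      rw [← genTranslateEquiv_apply, Equiv.apply_symm_apply]
  rw [hmap, Finset.card_map, List.toFinset_card_of_nodup hnd, hlen,
    Fibre.tightRealisable_map_iff (zDEMₛ σ S T N₀) (scope N₀) (zSymmₛ σ S T N₀ t)]
  have hbud : w - e.leaf.k = e.leaf.budget := by unfold Fibre.Leaf.budget; rw [hwe]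
  rw [hbud]
  exact Fibre.not_tightRealisable_of_leaf (zDEMₛ σ S T N₀) (scope N₀) encDet e.word hnd e.leaf hcovers hwfe hunsat hb

end Summit.Ventures.QEC.CircuitDistance
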